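import Summits.BirchSwinnertonDyer.BirchSwinnertonDyer.Theorems.CMKolyvaginAtInertTwoGenusDefectShaDescentAtTwo
import HarnessLib

/-!
# Route `CMKolyvaginAtInertTwo`, crux `CMKolyvaginExactAtInertTwo` (stmt-BirchSwinnertonDyer-24277) —
# Ш-VALUED RUNGS: gk2-p2's four rung lemmas with the double clause (`x_i ∈ Ш(W/ℚ)`, `x'_i ∈ Ш(W^{(d_K)}/ℚ)`)

Seat `bsd-line-cmk2-p1` g20 (cell `bsd-print-cf2`), `--supports stmt-BirchSwinnertonDyer-24277` (helper; closes nothing).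
THEOREMS ONLY (no definition, no named fact, no `sorry`).  BSD is NOT proved by this.

Step (a), second half, of the threading of memo `MEMO-genus-triviality.md` §6.2 (see the companion file
`CMKolyvaginAtInertTwoGenusDefectShaDescentAtTwo`): the rung lemmas of gk2-p2 (`exists_shaFamily_of_fixed_selmerFamily(_of_injective)`,
`exists_shaFamily_twin_of_antifixed_selmerFamily(_of_divisible)`) re-proved with the extra DOUBLE CLAUSE on the K-side family
(`z_i = 2z'_i`, `z'_i` an eigenclass of the same sign, Selmer at the places of `K` over `d_K`) and the stronger conclusion
`x_i ∈ Ш(X/ℚ)` / `x'_i ∈ Ш(X^{(d_K)}/ℚ)` (genus components killed by the doubling — Dokchitser–Dokchitser), the twin taken in the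
model `X.quadraticTwist d_K`.

* `exists_torsionFamily_of_conjAct_eq`, `exists_torsionFamily_twist_of_conjAct_eq_neg` (torsion-level descents with relations);
* `exists_shaFamilyQ_of_fixed_selmerFamily_of_double(_of_injective)` (fixed side, Kummer condition over `K` / over `ℚ`);
* `exists_shaFamilyQ_twist_of_antifixed_selmerFamily_of_double(_of_divisible)` (anti-fixed side).

References: [McCallumLMS1991] §5 Prop. 5.2, Thm. 5.4; [GrossLMS1991] §5 (5.1), Prop. 5.4; [DokchitserDokchitserAnnals2010] Lemma 4.14;
[SilvermanAEC2009] X.5 Cor. 5.4.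
-/

set_option autoImplicit false
-- the Theorems namespace of this sub repeats the summit name by design (D-0017 nested layout)
set_option linter.dupNamespace false

noncomputable section

open scoped Classical

namespace Summit.BirchSwinnertonDyer.BirchSwinnertonDyer.Theorems.KolyvaginGenusTwo

open WeierstrassCurve NumberField IsDedekindDomain Field Rat.HeightOneSpectrum
open Literature.NumberTheory.EllipticCurves Literature.NumberTheory.GaloisRepresentations
open Literature.NumberTheory.QuadraticFields
open Summit.BirchSwinnertonDyer.BirchSwinnertonDyer.Theorems.GenusExact
open Summit.BirchSwinnertonDyer.BirchSwinnertonDyer.Theorems.GenusExact.PlusDescent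
open Summit.BirchSwinnertonDyer.Rank1Residual.P2

/-! ## §3 One rung with `x_i ∈ Ш(·/ℚ)`: the four configurations of gk2-p2's rung lemmas, double clause added -/

section Rung

variable (X : WeierstrassCurve ℚ) [X.IsElliptic] (K : Type) [Field K] [NumberField K]
  (h2 : Module.finrank ℚ K = 2) (σ : K ≃ₐ[ℚ] K) (hσ : σ ≠ 1) (n : ℤ)

omit [X.IsElliptic] in
/-- Torsion-level descent of a fixed family with transfer of relations (`res` injective as `X(K)[n] = 0`).
[cite: GrossLMS1991, §5 (5.1)] -/
theorem exists_torsionFamily_of_conjAct_eq {θ : K} {c : ℚ} (hθ : θ ∉ Set.range (algebraMap ℚ K)) (hc : θ ^ 2 = algebraMap ℚ K c)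
    (hL : ∀ P : (X.baseChange K).toAffine.Point, n • P = 0 → P = 0)
    {s : ℕ} (z : Fin s → galH1Torsion (X.baseChange K) n) (hfix : ∀ i, conjAct X (sigmaQ K h2 hθ hc) n (z i) = z i) :
    ∃ xt : Fin s → galH1Torsion X n, (∀ i, resTorsion X K n (xt i) = z i) ∧
      ∀ e : Fin s → ℤ, ∑ i, e i • z i = 0 ↔ ∑ i, e i • xt i = 0 := by
  have hdesc : ∀ i, ∃ xt : galH1Torsion X n, resTorsion X K n xt = z i := fun i ↦
    (EigenClassesFinite.existsUnique_resTorsion_eq_of_conjAct_eq X K h2 hθ hc n hL (hfix i)).exists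
  choose xt hxt using hdesc
  have hinjres := EigenClassesFinite.resTorsion_injective_of_noTorsion X K h2 hθ hc n hL
  refine ⟨xt, hxt, fun e ↦ ?_⟩
  have h := sum_zsmul_map_eq_zero_iff_of_injOn_span (resTorsion X K n) xt (fun e' he' ↦ hinjres (by rw [he', map_zero])) e
  simpa only [hxt] using h

include h2 hσ in
/-- **RUNG, FIXED SIDE, Kummer condition over `K`, WITH `x_i ∈ Ш(X/ℚ)`.** As gk2-p2's `exists_shaFamily_of_fixed_selmerFamily`
(`K` quadratic, `σ ≠ 1`, `X(K)[n] = 0`; `z` Selmer, `σ`-fixed, orders `2^a`, independent modulo `2^a`, span meeting the Kummer kernel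
trivially), plus: each `z_i = 2z'_i` with `z'_i` fixed and Selmer at the places over `d_K`, the real Selmer condition of `X` is empty
(`Δ < 0`) and (desc-fin) for `X` off `d_K`.  THEN the descended classes lie in `Ш(X/ℚ)`, with orders `2^a`, independent modulo `2^a`.
[cite: McCallumLMS1991, §5 Prop. 5.2, Thm. 5.4 (p. 310)] [cite: GrossLMS1991, §5 (5.1)] [cite: DokchitserDokchitserAnnals2010, Lemma 4.14 (proof)] -/
theorem exists_shaFamilyQ_of_fixed_selmerFamily_of_double
    (hL : ∀ P : (X.baseChange K).toAffine.Point, n • P = 0 → P = 0)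
    (hinf : ∀ v : InfinitePlace ℚ, selmerLocalKer X v.Completion n = ⊤)
    (hoff : ∀ (v : HeightOneSpectrum (𝓞 ℚ)) (ξ : galH1Torsion X n), ¬ ((primesEquiv v : ℕ) : ℤ) ∣ NumberField.discr K →
      (∀ w : HeightOneSpectrum (𝓞 K), w.under (𝓞 ℚ) = v →
        resTorsion X K n ξ ∈ selmerLocalKer (X.baseChange K) (w.adicCompletion K) n) →
      ξ ∈ selmerLocalKer X (v.adicCompletion ℚ) n)
    {s a : ℕ} (z : Fin s → galH1Torsion (X.baseChange K) n)
    (hsel : ∀ i, z i ∈ selmerGroup (X.baseChange K) n)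
    (hfix : ∀ i, conjAct X σ n (z i) = z i)
    (hdbl : ∀ i, ∃ z' : galH1Torsion (X.baseChange K) n, z i = 2 • z' ∧ conjAct X σ n z' = z' ∧
      ∀ w : HeightOneSpectrum (𝓞 K), ((NumberField.discr K : ℤ) : 𝓞 K) ∈ w.asIdeal →
        z' ∈ selmerLocalKer (X.baseChange K) (w.adicCompletion K) n)
    (hker : ∀ e : Fin s → ℤ, torsionH1ToH1 (X.baseChange K) n (∑ i, e i • z i) = 0 → ∑ i, e i • z i = 0)
    (hord : ∀ i, addOrderOf (z i) = 2 ^ a)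
    (hind : ∀ e : Fin s → ℤ, ∑ i, e i • z i = 0 → ∀ i, ((2 ^ a : ℕ) : ℤ) ∣ e i) :
    ∃ x : Fin s → X.galH1, (∀ i, x i ∈ X.sha) ∧ (∀ i, addOrderOf (x i) = 2 ^ a) ∧
      ∀ e : Fin s → ℤ, ∑ i, e i • x i = 0 → ∀ i, ((2 ^ a : ℕ) : ℤ) ∣ e i := by
  obtain ⟨θ, c, hθ, hc⟩ := Quadratic.exists_sq_eq_algebraMap (F := ℚ) (K := K) h2
  have hσ' : σ = sigmaQ K h2 hθ hc := eq_sigmaQ_of_ne_one K h2 σ hσ hθ hc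
  subst hσ'
  obtain ⟨xt, hxt, hz⟩ := exists_torsionFamily_of_conjAct_eq X K h2 n hθ hc hL z hfix
  -- relations of `x := ι ∘ xt` are those of `z`
  have hrel : ∀ e : Fin s → ℤ, ∑ i, e i • torsionH1ToH1 X n (xt i) = 0 ↔ ∑ i, e i • z i = 0 := fun e ↦ by
    refine ⟨fun h ↦ hker e ?_, fun h ↦ ?_⟩
    · have h1 : resBaseChange X K (∑ i, e i • torsionH1ToH1 X n (xt i)) = 0 := by rw [h, map_zero]
      rw [map_sum] at h1
      simp only [map_zsmul, ← torsionH1ToH1_resTorsion, hxt] at h1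
      rw [map_sum]
      simpa only [map_zsmul] using h1
    · have h1 := congrArg (torsionH1ToH1 X n) ((hz e).mp h)
      rw [map_sum, map_zero] at h1
      simpa only [map_zsmul] using h1
  refine ⟨fun i ↦ torsionH1ToH1 X n (xt i), fun i ↦ ?_, fun i ↦ (addOrderOf_eq_of_forall_sum_zsmul_eq_zero_iff _ z hrel i).trans (hord i),
    indep_of_forall_sum_zsmul_eq_zero_iff _ z hrel hind⟩
  obtain ⟨z', hzi, hfix', hsel'⟩ := hdbl i
  exact torsionH1ToH1_mem_sha_of_resTorsion_eq_double X K h2 hθ hc n hL hinf hoff (hxt i) (hsel i) hzi hfix' hsel'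

include h2 hσ in
/-- **RUNG, FIXED SIDE, Kummer condition over `ℚ`** (`H¹(ℚ, X[n]) ↪ H¹(ℚ, X)`: the rank-`0` member with torsion prime to `n`),
**WITH `x_i ∈ Ш(X/ℚ)`** — gk2-p2's `exists_shaFamily_of_fixed_selmerFamily_of_injective` plus the double clause.
[cite: McCallumLMS1991, §5 Thm. 5.4 (p. 310)] [cite: GrossLMS1991, §5 (5.1)] [cite: DokchitserDokchitserAnnals2010, Lemma 4.14 (proof)] -/
theorem exists_shaFamilyQ_of_fixed_selmerFamily_of_double_of_injective
    (hL : ∀ P : (X.baseChange K).toAffine.Point, n • P = 0 → P = 0)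
    (hinjQ : Function.Injective (torsionH1ToH1 X n))
    (hinf : ∀ v : InfinitePlace ℚ, selmerLocalKer X v.Completion n = ⊤)
    (hoff : ∀ (v : HeightOneSpectrum (𝓞 ℚ)) (ξ : galH1Torsion X n), ¬ ((primesEquiv v : ℕ) : ℤ) ∣ NumberField.discr K →
      (∀ w : HeightOneSpectrum (𝓞 K), w.under (𝓞 ℚ) = v →
        resTorsion X K n ξ ∈ selmerLocalKer (X.baseChange K) (w.adicCompletion K) n) →
      ξ ∈ selmerLocalKer X (v.adicCompletion ℚ) n)
    {s a : ℕ} (z : Fin s → galH1Torsion (X.baseChange K) n)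
    (hsel : ∀ i, z i ∈ selmerGroup (X.baseChange K) n)
    (hfix : ∀ i, conjAct X σ n (z i) = z i)
    (hdbl : ∀ i, ∃ z' : galH1Torsion (X.baseChange K) n, z i = 2 • z' ∧ conjAct X σ n z' = z' ∧
      ∀ w : HeightOneSpectrum (𝓞 K), ((NumberField.discr K : ℤ) : 𝓞 K) ∈ w.asIdeal →
        z' ∈ selmerLocalKer (X.baseChange K) (w.adicCompletion K) n)
    (hord : ∀ i, addOrderOf (z i) = 2 ^ a)
    (hind : ∀ e : Fin s → ℤ, ∑ i, e i • z i = 0 → ∀ i, ((2 ^ a : ℕ) : ℤ) ∣ e i) :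
    ∃ x : Fin s → X.galH1, (∀ i, x i ∈ X.sha) ∧ (∀ i, addOrderOf (x i) = 2 ^ a) ∧
      ∀ e : Fin s → ℤ, ∑ i, e i • x i = 0 → ∀ i, ((2 ^ a : ℕ) : ℤ) ∣ e i := by
  obtain ⟨θ, c, hθ, hc⟩ := Quadratic.exists_sq_eq_algebraMap (F := ℚ) (K := K) h2
  have hσ' : σ = sigmaQ K h2 hθ hc := eq_sigmaQ_of_ne_one K h2 σ hσ hθ hc
  subst hσ'
  obtain ⟨xt, hxt, hz⟩ := exists_torsionFamily_of_conjAct_eq X K h2 n hθ hc hL z hfix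
  have hrel : ∀ e : Fin s → ℤ, ∑ i, e i • torsionH1ToH1 X n (xt i) = 0 ↔ ∑ i, e i • z i = 0 := fun e ↦ by
    rw [hz]
    exact sum_zsmul_map_eq_zero_iff_of_injOn_span (torsionH1ToH1 X n) xt (fun e' he' ↦ hinjQ (by rw [he', map_zero])) e
  refine ⟨fun i ↦ torsionH1ToH1 X n (xt i), fun i ↦ ?_, fun i ↦ (addOrderOf_eq_of_forall_sum_zsmul_eq_zero_iff _ z hrel i).trans (hord i),
    indep_of_forall_sum_zsmul_eq_zero_iff _ z hrel hind⟩
  obtain ⟨z', hzi, hfix', hsel'⟩ := hdbl i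
  exact torsionH1ToH1_mem_sha_of_resTorsion_eq_double X K h2 hθ hc n hL hinf hoff (hxt i) (hsel i) hzi hfix' hsel'

omit [X.IsElliptic] in
/-- Torsion-level descent of an anti-fixed family to the twist `X^{(c)}` with transfer of relations (`hPsiKT ∘ res` injective).
[cite: GrossLMS1991, §5 (5.1)] -/
theorem exists_torsionFamily_twist_of_conjAct_eq_neg {θ : K} {c : ℚ} (hθ : θ ∉ Set.range (algebraMap ℚ K))
    (hc : θ ^ 2 = algebraMap ℚ K c)
    (hL : ∀ P : (X.baseChange K).toAffine.Point, n • P = 0 → P = 0)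
    {s : ℕ} (z : Fin s → galH1Torsion (X.baseChange K) n) (hanti : ∀ i, conjAct X (sigmaQ K h2 hθ hc) n (z i) = -z i) :
    ∃ xt : Fin s → galH1Torsion (X.quadraticTwist c) n,
      (∀ i, hPsiKT X K hθ hc n (resTorsion (X.quadraticTwist c) K n (xt i)) = z i) ∧
      ∀ e : Fin s → ℤ, ∑ i, e i • z i = 0 ↔ ∑ i, e i • xt i = 0 := by
  have hdesc : ∀ i, ∃ xt : galH1Torsion (X.quadraticTwist c) n,
      hPsiKT X K hθ hc n (resTorsion (X.quadraticTwist c) K n xt) = z i := fun i ↦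
    (EigenClassesFinite.existsUnique_hPsiKT_resTorsion_eq_of_conjAct_eq_neg X K h2 hθ hc n hL (hanti i)).exists
  choose xt hxt using hdesc
  have hinjres := EigenClassesFinite.resTorsion_twist_injective_of_noTorsion X K h2 hθ hc n hL
  set F : galH1Torsion (X.quadraticTwist c) n →+ galH1Torsion (X.baseChange K) n :=
    (hPsiKT X K hθ hc n).toAddMonoidHom.comp (resTorsion (X.quadraticTwist c) K n) with hF
  have hFx : ∀ i, F (xt i) = z i := fun i ↦ by rw [hF, AddMonoidHom.comp_apply, AddEquiv.coe_toAddMonoidHom, hxt]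
  refine ⟨xt, hxt, fun e ↦ ?_⟩
  have h := sum_zsmul_map_eq_zero_iff_of_injOn_span F xt (fun e' he' ↦ by
    rw [hF, AddMonoidHom.comp_apply, AddEquiv.coe_toAddMonoidHom, map_eq_zero_iff _ (hPsiKT X K hθ hc n).injective] at he'
    exact hinjres (by rw [he', map_zero])) e
  simpa only [hFx] using h

omit [X.IsElliptic] in
include h2 hσ in
/-- **RUNG, ANTI-FIXED SIDE (the twist `X^{(d_K)}`), Kummer condition over `K`, WITH `x'_i ∈ Ш(X^{(d_K)}/ℚ)`** — gk2-p2's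
`exists_shaFamily_twin_of_antifixed_selmerFamily` in the model `X.quadraticTwist d_K`, plus the double clause (`z'_i` anti-fixed,
Selmer at the places over `d_K`), the empty real condition and (desc-fin) for the twist.
[cite: McCallumLMS1991, §5 Prop. 5.2, Thm. 5.4 (p. 310)] [cite: GrossLMS1991, §5 (5.1), Prop. 5.4] [cite: SilvermanAEC2009, X.5 Cor. 5.4] -/
theorem exists_shaFamilyQ_twist_of_antifixed_selmerFamily_of_double [(X.quadraticTwist (NumberField.discr K : ℚ)).IsElliptic]
    (hL : ∀ P : (X.baseChange K).toAffine.Point, n • P = 0 → P = 0)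
    (hinf : ∀ v : InfinitePlace ℚ, selmerLocalKer (X.quadraticTwist (NumberField.discr K : ℚ)) v.Completion n = ⊤)
    (hoff : ∀ (v : HeightOneSpectrum (𝓞 ℚ)) (ξ : galH1Torsion (X.quadraticTwist (NumberField.discr K : ℚ)) n),
      ¬ ((primesEquiv v : ℕ) : ℤ) ∣ NumberField.discr K →
      (∀ w : HeightOneSpectrum (𝓞 K), w.under (𝓞 ℚ) = v →
        resTorsion (X.quadraticTwist (NumberField.discr K : ℚ)) K n ξ ∈
          selmerLocalKer ((X.quadraticTwist (NumberField.discr K : ℚ)).baseChange K) (w.adicCompletion K) n) →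
      ξ ∈ selmerLocalKer (X.quadraticTwist (NumberField.discr K : ℚ)) (v.adicCompletion ℚ) n)
    {s a : ℕ} (z : Fin s → galH1Torsion (X.baseChange K) n)
    (hsel : ∀ i, z i ∈ selmerGroup (X.baseChange K) n)
    (hanti : ∀ i, conjAct X σ n (z i) = -z i)
    (hdbl : ∀ i, ∃ z' : galH1Torsion (X.baseChange K) n, z i = 2 • z' ∧ conjAct X σ n z' = -z' ∧
      ∀ w : HeightOneSpectrum (𝓞 K), ((NumberField.discr K : ℤ) : 𝓞 K) ∈ w.asIdeal →
        z' ∈ selmerLocalKer (X.baseChange K) (w.adicCompletion K) n)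
    (hker : ∀ e : Fin s → ℤ, torsionH1ToH1 (X.baseChange K) n (∑ i, e i • z i) = 0 → ∑ i, e i • z i = 0)
    (hord : ∀ i, addOrderOf (z i) = 2 ^ a)
    (hind : ∀ e : Fin s → ℤ, ∑ i, e i • z i = 0 → ∀ i, ((2 ^ a : ℕ) : ℤ) ∣ e i) :
    ∃ y : Fin s → (X.quadraticTwist (NumberField.discr K : ℚ)).galH1,
      (∀ i, y i ∈ (X.quadraticTwist (NumberField.discr K : ℚ)).sha) ∧ (∀ i, addOrderOf (y i) = 2 ^ a) ∧
      ∀ e : Fin s → ℤ, ∑ i, e i • y i = 0 → ∀ i, ((2 ^ a : ℕ) : ℤ) ∣ e i := by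
  obtain ⟨τ, θ₀, hτ, hθ₀, hsq, -, hall⟩ := exists_gal_ne_one_sqrt_discr (K := K) h2
  have hστ : σ = sigmaQ K h2 hθ₀ hsq := eq_sigmaQ_of_ne_one K h2 σ hσ hθ₀ hsq
  subst hστ
  set Xd := X.quadraticTwist (NumberField.discr K : ℚ)
  obtain ⟨xt, hxt, hz⟩ := exists_torsionFamily_twist_of_conjAct_eq_neg X K h2 n hθ₀ hsq hL z hanti
  have hrel : ∀ e : Fin s → ℤ, ∑ i, e i • torsionH1ToH1 Xd n (xt i) = 0 ↔ ∑ i, e i • z i = 0 := fun e ↦ by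
    refine ⟨fun h ↦ hker e ?_, fun h ↦ ?_⟩
    · have h1 : resBaseChange Xd K (∑ i, e i • torsionH1ToH1 Xd n (xt i)) = 0 := by rw [h, map_zero]
      rw [map_sum] at h1
      simp only [map_zsmul, ← torsionH1ToH1_resTorsion] at h1
      have h2' : torsionH1ToH1 (Xd.baseChange K) n (resTorsion Xd K n (∑ i, e i • xt i)) = 0 := by
        rw [map_sum, map_sum]
        simpa only [map_zsmul] using h1
      have hsumz : ∑ i, e i • z i = hPsiKT X K hθ₀ hsq n (resTorsion Xd K n (∑ i, e i • xt i)) := by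
        rw [map_sum, map_sum]
        exact Finset.sum_congr rfl fun i _ ↦ by rw [map_zsmul, map_zsmul, hxt]
      rw [hsumz, ← torsionH1ToH1_hPsiKT_symm_eq_zero_iff X K hθ₀ hsq n, AddEquiv.symm_apply_apply]
      exact h2'
    · have h1 := congrArg (torsionH1ToH1 Xd n) ((hz e).mp h)
      rw [map_sum, map_zero] at h1
      simpa only [map_zsmul] using h1
  refine ⟨fun i ↦ torsionH1ToH1 Xd n (xt i), fun i ↦ ?_,
    fun i ↦ (addOrderOf_eq_of_forall_sum_zsmul_eq_zero_iff _ z hrel i).trans (hord i), indep_of_forall_sum_zsmul_eq_zero_iff _ z hrel hind⟩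
  obtain ⟨z', hzi, hanti', hsel'⟩ := hdbl i
  exact torsionH1ToH1_twist_mem_sha_of_hPsiKT_resTorsion_eq_double X K h2 hθ₀ hsq n hL hinf hoff (hxt i) (hsel i) hzi hanti' hsel'

omit [X.IsElliptic] in
include h2 hσ in
/-- **RUNG, ANTI-FIXED SIDE, Kummer condition over `ℚ`** (`H¹(ℚ, X^{(d_K)}[n]) ↪ H¹(ℚ, X^{(d_K)})`: the twist of rank `0` with
`X^{(d_K)}(ℚ)` `n`-divisible), **WITH `x'_i ∈ Ш(X^{(d_K)}/ℚ)`** — gk2-p2's `exists_shaFamily_twin_of_antifixed_selmerFamily_of_divisible`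
in the model `X.quadraticTwist d_K`, plus the double clause. [cite: McCallumLMS1991, §5 Thm. 5.4 (p. 310)] [cite: GrossLMS1991, §5 (5.1)] -/
theorem exists_shaFamilyQ_twist_of_antifixed_selmerFamily_of_double_of_divisible
    [(X.quadraticTwist (NumberField.discr K : ℚ)).IsElliptic] (hn : n ≠ 0)
    (hL : ∀ P : (X.baseChange K).toAffine.Point, n • P = 0 → P = 0)
    (hdivXd : ∀ P : (X.quadraticTwist (NumberField.discr K : ℚ)).toAffine.Point,
      ∃ Q : (X.quadraticTwist (NumberField.discr K : ℚ)).toAffine.Point, n • Q = P)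
    (hinf : ∀ v : InfinitePlace ℚ, selmerLocalKer (X.quadraticTwist (NumberField.discr K : ℚ)) v.Completion n = ⊤)
    (hoff : ∀ (v : HeightOneSpectrum (𝓞 ℚ)) (ξ : galH1Torsion (X.quadraticTwist (NumberField.discr K : ℚ)) n),
      ¬ ((primesEquiv v : ℕ) : ℤ) ∣ NumberField.discr K →
      (∀ w : HeightOneSpectrum (𝓞 K), w.under (𝓞 ℚ) = v →
        resTorsion (X.quadraticTwist (NumberField.discr K : ℚ)) K n ξ ∈
          selmerLocalKer ((X.quadraticTwist (NumberField.discr K : ℚ)).baseChange K) (w.adicCompletion K) n) →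
      ξ ∈ selmerLocalKer (X.quadraticTwist (NumberField.discr K : ℚ)) (v.adicCompletion ℚ) n)
    {s a : ℕ} (z : Fin s → galH1Torsion (X.baseChange K) n)
    (hsel : ∀ i, z i ∈ selmerGroup (X.baseChange K) n)
    (hanti : ∀ i, conjAct X σ n (z i) = -z i)
    (hdbl : ∀ i, ∃ z' : galH1Torsion (X.baseChange K) n, z i = 2 • z' ∧ conjAct X σ n z' = -z' ∧
      ∀ w : HeightOneSpectrum (𝓞 K), ((NumberField.discr K : ℤ) : 𝓞 K) ∈ w.asIdeal →
        z' ∈ selmerLocalKer (X.baseChange K) (w.adicCompletion K) n)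
    (hord : ∀ i, addOrderOf (z i) = 2 ^ a)
    (hind : ∀ e : Fin s → ℤ, ∑ i, e i • z i = 0 → ∀ i, ((2 ^ a : ℕ) : ℤ) ∣ e i) :
    ∃ y : Fin s → (X.quadraticTwist (NumberField.discr K : ℚ)).galH1,
      (∀ i, y i ∈ (X.quadraticTwist (NumberField.discr K : ℚ)).sha) ∧ (∀ i, addOrderOf (y i) = 2 ^ a) ∧
      ∀ e : Fin s → ℤ, ∑ i, e i • y i = 0 → ∀ i, ((2 ^ a : ℕ) : ℤ) ∣ e i := by
  obtain ⟨τ, θ₀, hτ, hθ₀, hsq, -, hall⟩ := exists_gal_ne_one_sqrt_discr (K := K) h2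
  have hστ : σ = sigmaQ K h2 hθ₀ hsq := eq_sigmaQ_of_ne_one K h2 σ hσ hθ₀ hsq
  subst hστ
  set Xd := X.quadraticTwist (NumberField.discr K : ℚ)
  have hinjQ : Function.Injective (torsionH1ToH1 Xd n) := torsionH1ToH1_injective_of_divisible Xd hn (by convert hdivXd)
  obtain ⟨xt, hxt, hz⟩ := exists_torsionFamily_twist_of_conjAct_eq_neg X K h2 n hθ₀ hsq hL z hanti
  have hrel : ∀ e : Fin s → ℤ, ∑ i, e i • torsionH1ToH1 Xd n (xt i) = 0 ↔ ∑ i, e i • z i = 0 := fun e ↦ by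
    rw [hz]
    exact sum_zsmul_map_eq_zero_iff_of_injOn_span (torsionH1ToH1 Xd n) xt (fun e' he' ↦ hinjQ (by rw [he', map_zero])) e
  refine ⟨fun i ↦ torsionH1ToH1 Xd n (xt i), fun i ↦ ?_,
    fun i ↦ (addOrderOf_eq_of_forall_sum_zsmul_eq_zero_iff _ z hrel i).trans (hord i), indep_of_forall_sum_zsmul_eq_zero_iff _ z hrel hind⟩
  obtain ⟨z', hzi, hanti', hsel'⟩ := hdbl i
  exact torsionH1ToH1_twist_mem_sha_of_hPsiKT_resTorsion_eq_double X K h2 hθ₀ hsq n hL hinf hoff (hxt i) (hsel i) hzi hanti' hsel'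

end Rung

end Summit.BirchSwinnertonDyer.BirchSwinnertonDyer.Theorems.KolyvaginGenusTwo

end
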